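import Mathlib
import Summits.ValiantsHypothesis.ValiantsHypothesis.Theses.BarrierLever
import Literature.Computability.AlgebraicComplexity.RazUniversalCircuits

/-!
# Birth skeleton (BC3) for crux `BarrierLever.DefinableEquations` (stmt-ValiantsHypothesis-8745)

Line `raz-tableau` — **universality (Raz) + a short tableau equation (GCT) + Valiant's criterion at
scale `N`**.  The crux `DefinableEquations` asks for ONE level `a` such that for every size exponent
`b`, eventually in `n`, a NONZERO boolean sum `E = boolSum H` (`q`, `L(H)`, `deg H ≤ N^a`,
`N = C(2n,n)`) in the `N` coefficient variables vanishes at `coeff(f)` for every `f` of degree `≤ n`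
and circuit size `≤ n^b` (a `VNP_N`-natural proof against `VP`, Forbes–Shpilka–Volk Def. 1 with
𝒟 = boolean sums).  The line factors it through the EXPLICIT variety that carries all the structure:

* **Stub A `stub_razTopUniversality`** (Raz 2010 Prop. 3.3, tree theorem
  `RazUniversal.exists_eval_uCoeff_eq_coeff`, extended from homogeneous forms to the top homogeneous
  component of an arbitrary small circuit; known, size S–M).  For `f ∈ SmallCircuits ℂ n b`, `n ≥ 1`,
  the degree-`n` part of the coefficient vector of `f` is a value `Γ(y)` of Raz's integer polynomial
  map `Γ = (uCoeff ℂ (Fin n) n W e)_{|e| = n}` with `W = 4 n^b (n+1)²` slots.  Proof plan: rerun the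
  tree proof of `RazUniversal.exists_labels_of_complexity_le` with `g := f` (its generic case already
  shows `outVal (labels …) = homogeneousComponent n (S.val i)`; the degenerate cases `f = X j`, `f = C c`
  take `y = 0` / the `r = 1` leaf labelling) and read off `coeff e` for `|e| = n`.
* **Stub H `stub_shortTableauEquation`** (OPEN — the heart; GCT in the classical symbolic form).
  The image of `Γ` (top part) is a `GL_n`-stable irreducible cone in `Sym^n ℂ^n` of dimension
  `≤ #Lab = poly(n) ≪ N`, so its ideal is a nonzero `GL_n`-stable ideal, spanned in each degree by
  highest-weight vectors; the classical spanning set of highest-weight vectors (and of all bracket /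
  `SL_n`-invariant polynomials, First Fundamental Theorem) of `ℂ[Sym^n ℂ^n]_D` consists of the
  TABLEAU CONTRACTIONS `F_τ(f) = ⟨∏_columns det, t(f)^{⊗ D}⟩` (`TabDatum.poly` below: a signed sum over
  `i : Fin D × Fin n → Fin n` of products of `D` symmetric-tensor coordinates
  `t_e = (∏ e_l!) · c_e`, the sign being a product of determinants of `0/1` incidence matrices; cells
  of several positions also give flattening/catalecticant minors and Weyl conjugates, and products of
  data are data).  THE BET: for every `b`, eventually in `n`, some SHORT integer combination
  (`≤ N` data of degree `≤ N`, `≤ N` columns of size `≤ N`, coefficients `≤ 2^N`) is nonzero and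
  vanishes on the image of `Γ` — "the Raz variety has a short symbolic equation", the analogue for
  equations of an explicit (occurrence-like) obstruction; nothing is evaluated at the permanent.
  Why it might fail: minimal-degree equations have degree `≥ n^{b-2}` (sparse polynomials lie in
  `SmallCircuits`), and the highest-weight spaces there have super-polynomial multiplicity, so a
  vanishing vector could need exponentially long tableau expansions (all equations "succinct-linear-
  algebra hard", Chatterjee–Tengse 2023 open direction 2).  Sources: ForbesShpilkaVolk2018 §3,
  arXiv:2309.07612 Thm 1.3, arXiv:2002.11594 (complexity of highest-weight vectors),
  BurgisserIkenmeyerPanovaJAMS2019, LandsbergGCT2017 (symbolic method / HWVs via tableaux).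
* **Stub V `stub_tableauSumsDefinable`** (known mechanism — Valiant's criterion, Bürgisser 2000
  Prop. 2.20, tree `ValiantCriterion.boolSum_witness`, run at scale `N`; size L).  Every such short
  combination, renamed into the `N` coefficient variables, IS `boolSum H` with `q, L(H), deg H ≤ N^a`
  for ONE absolute `a` (encode `i` by `≤ N·n·log n` Boolean variables; the sign, the weights
  `∏ e_l!` and the variable selectors are `poly(N)`-size arithmetised Boolean gadgets; determinants
  are in `VP`).  The level `a` of the crux is V's `a` — independent of `b`, as the lever requires.

Composition `DefinableEquations_of` (sorry-free, pure logic + `rename` along the injective inclusion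
of top monomials): given `b`, H supplies `n₀` and, for `n ≥ n₀ + n₁ + 1`, a short datum with
`P ≠ 0` vanishing on the image of `Γ`; V turns `rename ι P` into a level-`a` boolean sum (nonzero by
`rename_injective`); for `f ∈ SmallCircuits ℂ n b`, A gives `y` with `coeffVector f ∘ ι = Γ(y)`, so
`eval (coeffVector f) (rename ι P) = eval (Γ y) P = 0`.

Disproof used: none exists for this crux (no `Cruxes/DefinableEquations/Disproof.lean`, negatives
index of the summit: 4 entries, all on determinantal representations / elusive maps — unrelated).
BC3 probes (`stub → DefinableEquations`, `stub → ValiantsHypothesis` by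
`first | exact? | simpa | aesop`, file `bc/probe.lean` of the registering seat): all six FAIL.

Shape (as `Cruxes/CutBites/Lines/pfaffian-square-address.lean`): §0 vocabulary (defs) · §1 the stub
statements as named Props `Sig.stub_*` (so that `DefinableEquations_of` takes the declared stubs BY
NAME, `#h21_check_skeleton` (ii)) · §2 the registered sorried stubs `stub_*` with the statements
spelled out · §3 `DefinableEquations_of` and the hypothesis-free `DefinableEquations_proof`.
-/

set_option linter.dupNamespace false

noncomputable section

namespace Summit.ValiantsHypothesis.ValiantsHypothesis.Cruxes.DefinableEquations.Birth

open MvPolynomial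
open Literature.Computability.AlgebraicComplexity Literature.Barriers.ValiantsHypothesis
open scoped BigOperators

/-! ## §0 Vocabulary: top monomials, Raz points, tableau contractions -/

/-- Exponents of degree EXACTLY `n` in `n` variables: the coordinates of `Sym^n ℂ^n` (the top
homogeneous component), a subset of the crux's `degLEMonomials n`. -/
def topMonomials (n : ℕ) : Set (Fin n →₀ ℕ) := {m | m.degree = n}

theorem topMonomials_subset (n : ℕ) : topMonomials n ⊆ degLEMonomials n :=
  fun _ hm => le_of_eq hm

/-- The inclusion of variable sets `topMonomials n ↪ degLEMonomials n`. -/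
def topIncl (n : ℕ) : topMonomials n → degLEMonomials n := Set.inclusion (topMonomials_subset n)

theorem topIncl_injective (n : ℕ) : Function.Injective (topIncl n) :=
  Set.inclusion_injective (topMonomials_subset n)

/-- The exponent vector of a block of `n` tensor indices `v : Fin n → Fin n` (symmetric-tensor slot
`t_v` ↦ monomial `∏ x_{v l}`). -/
def expOf {n : ℕ} (v : Fin n → Fin n) : Fin n →₀ ℕ := ∑ l : Fin n, Finsupp.single (v l) 1

theorem degree_expOf {n : ℕ} (v : Fin n → Fin n) : (expOf v).degree = n := by
  simp [expOf, map_sum]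

/-- `expOf v` as a top monomial. -/
def expTop {n : ℕ} (v : Fin n → Fin n) : topMonomials n := ⟨expOf v, degree_expOf v⟩

/-- The symmetric-tensor weight `∏_l e_l!` (`t_e = (∏ e_l!/n!) c_e`; the global `1/n!^D` is dropped). -/
def symWeight {n : ℕ} (e : Fin n →₀ ℕ) : ℕ := ∏ l : Fin n, (e l).factorial

/-- Raz's slot count for circuits of size `n ^ b` and degree `n` (`N ≥ 4 s (r+1)²` in
`RazUniversal.exists_eval_uCoeff_eq_coeff`). -/
def razSlots (n b : ℕ) : ℕ := 4 * n ^ b * (n + 1) ^ 2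

/-- The point `Γ(y)` of Raz's polynomial map on the top monomials: coordinate `e ↦ uCoeff_e (y)`. -/
def razPoint (n b : ℕ) (y : RazUniversal.Lab (Fin n) n (razSlots n b) → ℂ) : topMonomials n → ℂ :=
  fun e => eval y (RazUniversal.uCoeff ℂ (Fin n) n (razSlots n b) (e : Fin n →₀ ℕ))

/-- A TABLEAU-CONTRACTION DATUM on `D` blocks of `n` tensor positions: `L` columns, column `j` of
`size j` cells, each cell a set of positions with, for every row `b`, a template of prescribed
tensor indices.  (Cells = single positions with template "index = row" give the classical
highest-weight vectors `e_T`; half-block cells give flattening minors.) -/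
structure TabDatum (n : ℕ) where
  /-- number of copies of the form (degree of the contraction polynomial in the coefficients) -/
  D : ℕ
  /-- number of columns (determinant factors) -/
  L : ℕ
  /-- size of column `j` -/
  size : Fin L → ℕ
  /-- the cell of column `j`, row-slot `a`: a set of tensor positions -/
  cell : (j : Fin L) → Fin (size j) → Finset (Fin D × Fin n)
  /-- the template of column `j`, row `b`: prescribed indices on positions -/
  tmpl : (j : Fin L) → Fin (size j) → Fin D × Fin n → Fin n

namespace TabDatum

variable {n : ℕ}

/-- The sign `ε_τ(i) = ∏_j det M_j(i)`, `M_j(i)_{a b} = [i agrees with template (j,b) on cell (j,a)]`. -/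
def sign (τ : TabDatum n) (i : Fin τ.D × Fin n → Fin n) : ℤ :=
  ∏ j : Fin τ.L, Matrix.det (Matrix.of fun a b : Fin (τ.size j) =>
    if ∀ p ∈ τ.cell j a, i p = τ.tmpl j b p then (1 : ℤ) else 0)

/-- The tableau-contraction polynomial `F_τ = ∑_i ε_τ(i) ∏_{k < D} t_{i|block k}` in the top
coefficient variables (`t_e = (∏ e_l!) · c_e`). -/
def poly (τ : TabDatum n) : MvPolynomial (topMonomials n) ℂ :=
  ∑ i : Fin τ.D × Fin n → Fin n, (τ.sign i : ℂ) •
    ∏ k : Fin τ.D, ((symWeight (expOf fun l => i (k, l)) : ℂ) • X (expTop fun l => i (k, l)))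

/-- Size bound on a datum: `D, L ≤ B` and all column sizes `≤ B`. -/
def Bounded (B : ℕ) (τ : TabDatum n) : Prop :=
  τ.D ≤ B ∧ τ.L ≤ B ∧ ∀ j, τ.size j ≤ B

end TabDatum

/-- A short integer combination of tableau contractions. -/
def combPoly {n k : ℕ} (τ : Fin k → TabDatum n) (a : Fin k → ℤ) : MvPolynomial (topMonomials n) ℂ :=
  ∑ i : Fin k, (a i : ℂ) • (τ i).poly

/-- Shortness: `k ≤ B` data, each `B`-bounded, integer coefficients of absolute value `≤ 2 ^ B`. -/
def ShortComb (B : ℕ) {n k : ℕ} (τ : Fin k → TabDatum n) (a : Fin k → ℤ) : Prop :=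
  k ≤ B ∧ (∀ i, (τ i).Bounded B) ∧ ∀ i, (a i).natAbs ≤ 2 ^ B

/-! ## §1 The stub statements as named propositions

(The last name component of each `Sig.stub_*` is the registered stub's name, so that the composition
`DefinableEquations_of` takes "declared stubs by name" in the sense of `#h21_check_skeleton` (ii).) -/

namespace Sig

/-- **Stub A** — Raz universality for the top component (known; S–M). -/
def stub_razTopUniversality : Prop :=
  ∀ n b : ℕ, 1 ≤ n → ∀ f ∈ SmallCircuits ℂ n b,
    ∃ y : RazUniversal.Lab (Fin n) n (razSlots n b) → ℂ,
      ∀ e : topMonomials n, razPoint n b y e = coeff (e : Fin n →₀ ℕ) f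

/-- **Stub H** — a short tableau equation for the Raz variety (OPEN; the heart). -/
def stub_shortTableauEquation : Prop :=
  ∀ b : ℕ, ∃ n₀ : ℕ, ∀ n ≥ n₀, ∃ (k : ℕ) (τ : Fin k → TabDatum n) (a : Fin k → ℤ),
    ShortComb (Nat.choose (2 * n) n) τ a ∧ combPoly τ a ≠ 0 ∧
      ∀ y : RazUniversal.Lab (Fin n) n (razSlots n b) → ℂ, eval (razPoint n b y) (combPoly τ a) = 0

/-- **Stub V** — short tableau combinations are uniformly p-definable at scale `N` (known mechanism; L). -/
def stub_tableauSumsDefinable : Prop :=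
  ∃ a n₁ : ℕ, ∀ n ≥ n₁, ∀ (k : ℕ) (τ : Fin k → TabDatum n) (c : Fin k → ℤ),
    ShortComb (Nat.choose (2 * n) n) τ c →
      ∃ q : ℕ, q ≤ (Nat.choose (2 * n) n) ^ a ∧
        ∃ H : MvPolynomial (↥(degLEMonomials n) ⊕ Fin q) ℂ,
          complexity H ≤ (Nat.choose (2 * n) n) ^ a ∧ H.totalDegree ≤ (Nat.choose (2 * n) n) ^ a ∧
            boolSum H = rename (topIncl n) (combPoly τ c)

end Sig

/-! ## §2 The registered stubs (statements spelled out; `sorry` lives only here) -/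

/-- **Stub A (registered)** — Raz universality for the top homogeneous component: for `n ≥ 1` and
`f` of degree `≤ n` and fan-in-two size `≤ n ^ b`, the degree-`n` coefficients of `f` are the values
at some labelling `y` of Raz's map `Γ = (uCoeff ℂ (Fin n) n (4 n^b (n+1)²) e)_{|e| = n}`.
Plan: the tree proof of `RazUniversal.exists_labels_of_complexity_le` run with `g := f`, `s := n^b`,
`r := n` (generic case: `outVal (labels (S.homogenize n) n emb ν₀) = homogeneousComponent n f`;
leaf/constant cases: `y = 0` or the `r = 1` leaf labelling), then `coeff_homogeneousComponent`.
Size S–M; Raz 2010 Prop. 3.3 (2). -/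
theorem stub_razTopUniversality :
    ∀ n b : ℕ, 1 ≤ n → ∀ f ∈ SmallCircuits ℂ n b,
      ∃ y : RazUniversal.Lab (Fin n) n (razSlots n b) → ℂ,
        ∀ e : topMonomials n, razPoint n b y e = coeff (e : Fin n →₀ ℕ) f := by
  sorry

/-- **Stub H (registered)** — the short tableau equation (OPEN): for every size exponent `b`,
eventually in `n`, some integer combination of `k ≤ N` tableau contractions (`D, L`, column sizes
`≤ N`, coefficients `≤ 2^N` in absolute value, `N = C(2n,n)`) is a nonzero polynomial in the top
coefficient variables vanishing on the image of Raz's map `Γ` (slots `4 n^b (n+1)²`). -/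
theorem stub_shortTableauEquation :
    ∀ b : ℕ, ∃ n₀ : ℕ, ∀ n ≥ n₀, ∃ (k : ℕ) (τ : Fin k → TabDatum n) (a : Fin k → ℤ),
      ShortComb (Nat.choose (2 * n) n) τ a ∧ combPoly τ a ≠ 0 ∧
        ∀ y : RazUniversal.Lab (Fin n) n (razSlots n b) → ℂ,
          eval (razPoint n b y) (combPoly τ a) = 0 := by
  sorry

/-- **Stub V (registered)** — Valiant's criterion at scale `N` for tableau contractions (known
mechanism, size L): ONE level `a` and a threshold `n₁` such that for `n ≥ n₁` every short
combination (bounds `N = C(2n,n)`), renamed into the `degLEMonomials n` variables, equals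
`boolSum H` for some `H` with `q`, `L(H)`, `deg H ≤ N ^ a`. -/
theorem stub_tableauSumsDefinable :
    ∃ a n₁ : ℕ, ∀ n ≥ n₁, ∀ (k : ℕ) (τ : Fin k → TabDatum n) (c : Fin k → ℤ),
      ShortComb (Nat.choose (2 * n) n) τ c →
        ∃ q : ℕ, q ≤ (Nat.choose (2 * n) n) ^ a ∧
          ∃ H : MvPolynomial (↥(degLEMonomials n) ⊕ Fin q) ℂ,
            complexity H ≤ (Nat.choose (2 * n) n) ^ a ∧ H.totalDegree ≤ (Nat.choose (2 * n) n) ^ a ∧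
              boolSum H = rename (topIncl n) (combPoly τ c) := by
  sorry

/-! ## §3 Composition (sorry-free) -/

/-- **The line closes the crux**: universality (A) + short tableau equation (H) + definability (V)
give `BarrierLever.DefinableEquations`, with the level `a` of stub V (independent of `b`).  Pure
logic plus `MvPolynomial.eval_rename` / `rename_injective` along the inclusion of top monomials. -/
theorem DefinableEquations_of :
    Sig.stub_razTopUniversality → Sig.stub_shortTableauEquation → Sig.stub_tableauSumsDefinable →
      Summit.ValiantsHypothesis.ValiantsHypothesis.Theses.BarrierLever.DefinableEquations := by
  intro hA hH hV
  obtain ⟨a, n₁, hV⟩ := hV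
  refine ⟨a, fun b => ?_⟩
  obtain ⟨n₀, hH⟩ := hH b
  refine ⟨n₀ + n₁ + 1, fun n hn => ?_⟩
  obtain ⟨k, τ, cf, hshort, hne, hvan⟩ := hH n (by omega)
  obtain ⟨q, hq, H, hHc, hHd, hsum⟩ := hV n (by omega) k τ cf hshort
  refine ⟨q, hq, H, hHc, hHd, ?_, ?_⟩
  · rw [hsum]
    intro h0
    apply hne
    apply MvPolynomial.rename_injective _ (topIncl_injective n)
    rw [h0, map_zero]
  · intro f hf
    obtain ⟨y, hy⟩ := hA n b (by omega) f hf
    rw [hsum, MvPolynomial.eval_rename]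
    have hpt : (coeffVector (degLEMonomials n) f ∘ topIncl n) = razPoint n b y := by
      funext e
      rw [Function.comp_apply, coeffVector_apply, hy e]
      rfl
    rw [hpt]
    exact hvan y

/-- **The skeleton**: `BarrierLever.DefinableEquations` BY NAME, modulo exactly the three registered
stubs. -/
theorem DefinableEquations_proof :
    Summit.ValiantsHypothesis.ValiantsHypothesis.Theses.BarrierLever.DefinableEquations :=
  DefinableEquations_of stub_razTopUniversality stub_shortTableauEquation stub_tableauSumsDefinable

end Summit.ValiantsHypothesis.ValiantsHypothesis.Cruxes.DefinableEquations.Birth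

end
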